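import Summits.ValiantsHypothesis.ValiantsHypothesis.Theorems.BarrierLeverAnchoredDoorHitsLowerPairsStubGenericPoint
import Summits.ValiantsHypothesis.ValiantsHypothesis.Theorems.BarrierLeverPartitionMinorsHitByVPAnchoredDoorCubeBall

/-!
# Support item `AnchoredDoorHitsLowerPairs` (stmt-ValiantsHypothesis-22510), line `anchored-peeling`:
# the SYMBOLIC MINOR of 𝔄₂ is nonzero on cube-versus-Hamming-ball at every height

Helper file (`--supports stmt-ValiantsHypothesis-22510`; cell valiant-natproofs, rung V4, 𝒟-side door (c); prover seat val-np-p1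
gen 14). Closes NO item. In the skeleton's own language (`symbolicDet`, Theorems-side copy `…AnchoredDoorHitsLowerPairsDefs`):
`symbolicDet_cubeBall_ne_zero` — for `s = 2`, `h = 2k+1`, rows ranging injectively over subsets of the first `2k` `x`-vertices and
columns containing the radius-`k` `y`-ball, `symbolicDet 2 (2k+1) r u w ≠ 0`. Proof: the member of 𝔄₂ at the 0/1 point
`cubeBallPoint k` IS the cube-versus-ball witness `CubeBall.witness k k` (`anchoredWitness_cubeBallPoint`; the selected anchors are
`(x_a | y_a)`, `a ∈ X_k`, and `(x_{2j}x_{2j+1} | y_d)`, `d ∈ Y_j`, all of profile ≤ 2), whose minor is nonzero by hard Lefschetz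
(`CubeBall.det_cubeBall_witness_ne_zero`, p568617), and a numeric hit makes the symbolic minor nonzero (`symbolicDet_ne_zero_of_hit`,
p575512). So the open content stub holds on the cell's stress family — a family WITHOUT star(2) steps for `k ≥ 3` (memo §6.1), i.e.
inside the residual «rigid pairs» class of the proposed v3 sub-stub `stub_rigidPairs`.

WHAT THIS IS NOT: one family; nothing on `stub_symbolicNonvanishing` in general, on crux stmt-ValiantsHypothesis-14610, or on
`VP` versus `VNP`.
-/

set_option linter.dupNamespace false

namespace Summit.ValiantsHypothesis.ValiantsHypothesis.Theorems.BarrierLever.AnchoredPeeling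

open Finset MvPolynomial
open Summit.ValiantsHypothesis.ValiantsHypothesis.Theorems.BarrierLever.BrickCalculus (brick brick_eq pexpo)
open Summit.ValiantsHypothesis.ValiantsHypothesis.Theorems.BarrierLever.CubeBall
open Summit.ValiantsHypothesis.ValiantsHypothesis.Theorems.BarrierLever.AnchoredDoor (witness_eq_prod prod_range_two_mul)

noncomputable section

/-- The vertex anchors `(x_a | y_a)`, `a ∈ X_k`. -/
def vertexAnchors (k : ℕ) : Finset (Finset (Fin (2 * k + 1)) × Finset (Fin (2 * k + 1))) :=
  (xSet k k).image fun a => ({a}, {a})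

/-- The pair anchors `(x_{2j} x_{2j+1} | y_d)`, `j < k`, `d ∈ Y_j`. -/
def pairAnchors (k : ℕ) : Finset (Finset (Fin (2 * k + 1)) × Finset (Fin (2 * k + 1))) :=
  (Finset.range k).biUnion fun j => (ySet k j).image fun d => ({vtx k (2 * j), vtx k (2 * j + 1)}, {d})

open Classical in
/-- The 0/1 parameter point of the cube-versus-ball witness inside 𝔄₂ (all twists `0`). -/
def cubeBallPoint (k : ℕ) : Param (2 * k + 1) → ℂ
  | Sum.inl α => if α ∈ vertexAnchors k ∪ pairAnchors k then 1 else 0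
  | Sum.inr _ => 0

/-- The vertex anchors have profile `(1,1) ≤ 2`. -/
theorem vertexAnchors_subset (k : ℕ) : vertexAnchors k ⊆ anchors 2 (2 * k + 1) := by
  intro α hα
  obtain ⟨a, -, rfl⟩ := Finset.mem_image.mp hα
  simp [anchors]

/-- The pair anchors have profile `(2,1) ≤ 2`. -/
theorem pairAnchors_subset (k : ℕ) : pairAnchors k ⊆ anchors 2 (2 * k + 1) := by
  intro α hα
  obtain ⟨j, hj, hα'⟩ := Finset.mem_biUnion.mp hα
  obtain ⟨d, -, rfl⟩ := Finset.mem_image.mp hα'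
  have hjk : j < k := Finset.mem_range.mp hj
  simp [anchors, Finset.card_pair (vtx_two_mul_ne hjk)]

/-- Vertex anchors and pair anchors are distinct (their `x`-parts have sizes `1` and `2`). -/
theorem disjoint_vertexAnchors_pairAnchors (k : ℕ) : Disjoint (vertexAnchors k) (pairAnchors k) := by
  rw [Finset.disjoint_left]
  intro α hα hα'
  obtain ⟨a, -, rfl⟩ := Finset.mem_image.mp hα
  obtain ⟨j, hj, hα''⟩ := Finset.mem_biUnion.mp hα'
  obtain ⟨d, -, hd⟩ := Finset.mem_image.mp hα''
  have := congrArg (fun p => p.1.card) hd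
  simp only [Finset.card_singleton, Finset.card_pair (vtx_two_mul_ne (Finset.mem_range.mp hj))] at this
  exact absurd this (by norm_num)

/-- **The member of 𝔄₂ at the 0/1 point is the cube-versus-ball witness.** -/
theorem anchoredWitness_cubeBallPoint (k : ℕ) :
    anchoredWitness 2 (2 * k + 1) (fun α => cubeBallPoint k (Sum.inl α))
      (fun α b => cubeBallPoint k (Sum.inr (Sum.inl (α, b)))) (fun α d => cubeBallPoint k (Sum.inr (Sum.inr (α, d)))) =
      witness k k := by
  classical
  -- all twists vanish; selected anchors give weight-one bricks
  have hfac : ∀ α : Finset (Fin (2 * k + 1)) × Finset (Fin (2 * k + 1)),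
      (1 + C (cubeBallPoint k (Sum.inl α)) * (∏ a ∈ α.1, X (Fin.castAdd (2 * k + 1) a)) *
        (∏ c ∈ α.2, X (Fin.natAdd (2 * k + 1) c)) *
        (∏ b ∈ univ \ α.1, (1 + C (cubeBallPoint k (Sum.inr (Sum.inl (α, b)))) * X (Fin.castAdd (2 * k + 1) b))) *
        (∏ d ∈ univ \ α.2, (1 + C (cubeBallPoint k (Sum.inr (Sum.inr (α, d)))) * X (Fin.natAdd (2 * k + 1) d))) :
          MvPolynomial (Fin ((2 * k + 1) + (2 * k + 1))) ℂ) =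
        if α ∈ vertexAnchors k ∪ pairAnchors k then brick α.1 α.2 else 1 := by
    intro α
    simp only [cubeBallPoint, map_zero, zero_mul, add_zero, Finset.prod_const_one, mul_one]
    split_ifs with hsel
    · rw [brick]
    · rw [map_zero, zero_mul, zero_mul, add_zero]
  rw [anchoredWitness, Finset.prod_congr rfl (fun α _ => hfac α), ← Finset.prod_filter, Finset.filter_mem_eq_inter,
    Finset.inter_eq_right.mpr (Finset.union_subset (vertexAnchors_subset k) (pairAnchors_subset k)),
    Finset.prod_union (disjoint_vertexAnchors_pairAnchors k)]
  -- vertex anchors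
  have hV : ∏ α ∈ vertexAnchors k, brick α.1 α.2 = ∏ a ∈ xSet k k, brick {a} {a} := by
    rw [vertexAnchors, Finset.prod_image]
    intro a _ b _ hab
    exact Finset.singleton_injective (congrArg Prod.fst hab)
  -- pair anchors
  have hP : ∏ α ∈ pairAnchors k, brick α.1 α.2 =
      ∏ j ∈ Finset.range k, ∏ d ∈ ySet k j, brick {vtx k (2 * j), vtx k (2 * j + 1)} {d} := by
    rw [pairAnchors, Finset.prod_biUnion]
    · refine Finset.prod_congr rfl (fun j _ => ?_)
      rw [Finset.prod_image]
      intro d _ d' _ hdd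
      exact Finset.singleton_injective (congrArg Prod.snd hdd)
    · intro j hj j' hj' hjj
      rw [Function.onFun, Finset.disjoint_left]
      intro α hα hα'
      obtain ⟨d, -, rfl⟩ := Finset.mem_image.mp hα
      obtain ⟨d', -, hd'⟩ := Finset.mem_image.mp hα'
      have h1 := congrArg Prod.fst hd'
      simp only at h1
      have hjk : j < k := Finset.mem_range.mp hj
      have hjk' : j' < k := Finset.mem_range.mp hj'
      have hmem : vtx k (2 * j') ∈ ({vtx k (2 * j), vtx k (2 * j + 1)} : Finset (Fin (2 * k + 1))) := by
        rw [← h1]; exact Finset.mem_insert_self _ _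
      rcases Finset.mem_insert.mp hmem with h2 | h2
      · have := vtx_inj (by omega) (by omega) h2; omega
      · have := vtx_inj (by omega) (by omega) (Finset.mem_singleton.mp h2); omega
  rw [hV, hP, witness_eq_prod]
  have hblock : ∀ j, blockW k j = (brick {vtx k (2 * j)} {vtx k (2 * j)} * brick {vtx k (2 * j + 1)} {vtx k (2 * j + 1)}) *
      ∏ d ∈ ySet k j, brick {vtx k (2 * j), vtx k (2 * j + 1)} {d} := fun j => rfl
  simp_rw [hblock]
  rw [Finset.prod_mul_distrib, ← prod_range_two_mul (fun i => brick {vtx k i} {vtx k i}) k, xSet, Finset.prod_image]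
  intro i hi i' hi' hv
  exact vtx_inj (by have := Finset.mem_range.mp hi; omega) (by have := Finset.mem_range.mp hi'; omega) hv

/-- **The symbolic minor of 𝔄₂ is nonzero on cube-versus-Hamming-ball, every `k`.** -/
theorem symbolicDet_cubeBall_ne_zero (k : ℕ) {r : ℕ} (u w : Fin r → Finset (Fin (2 * k + 1)))
    (hu : Function.Injective u) (hur : ∀ i, vtx k (2 * k) ∉ u i)
    (hwr : ∀ T : Finset (Fin (2 * k + 1)), T.card ≤ k → T ∈ Set.range w) :
    symbolicDet 2 (2 * k + 1) r u w ≠ 0 := by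
  refine symbolicDet_ne_zero_of_hit 2 (2 * k + 1) r u w (cubeBallPoint k) ?_
  rw [anchoredWitness_cubeBallPoint]
  exact det_cubeBall_witness_ne_zero k u w hu hur hwr

end

end Summit.ValiantsHypothesis.ValiantsHypothesis.Theorems.BarrierLever.AnchoredPeeling
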